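import Mathlib
import Summits.Ventures.HodgeRepro.Tier4.Target
import Summits.Ventures.HodgeRepro.Tier4.Line3.Defs
import Summits.Ventures.HodgeRepro.Tier4.Line3.LocaliserS
import Summits.Ventures.HodgeRepro.Tier4.Line3.TorusInvariance
import Summits.Ventures.HodgeRepro.Tier4.Line3.CongruenceIndex
import Summits.Ventures.HodgeRepro.Tier4.Line3.InvariantMajorantDef
import Summits.Ventures.HodgeRepro.Tier4.Line3.InvariantRouteAssembly

/-!
# Tier4/Line3/InvariantSupportSet — a `Γ`-stable set of line tuples containing the support of a localiser (rung (I2))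

Blind re-derivation cell `pub-hodge-repro`, Tier 4 «PROVE THE STEP» (README §9–§10), LINE L3, seat t4-L2-p3 (gen 2,
on L3.5 `term_dominated`); rung (I2) of the invariant-majorant route (S12951, S13087).

`LocS.supp` places the support of the depth-`N` localiser in the lines of the cosets `xm + (𝔭𝔭̄)^N L`, `L` in a finite
set `S` of `𝒪`-lattices containing `xm`.  The lattices of `S` are finitely generated, so their coordinates have a
common denominator `D ∈ 𝒪 ∖ {0}` (`IsLocalization.exist_integer_multiples` for the fraction field `E′` of `𝒪`):
every `L ∈ S` lies in `D⁻¹ 𝒪³` (`scaledStdLattice D`, the `𝒪`-span of the `D⁻¹ e_i`).  That lattice is `Γ`-STABLE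
because the elements of `Γ` are INTEGRAL matrices (`CongruenceIndex.isIntegralMatrix_of_mem`): `γ (D⁻¹ e_i) = Σ_k γ_{ki}
D⁻¹ e_k`.  Hence `S′ := {w | ∃ x, lines x = w ∧ ∀ j, x j ∈ D⁻¹ 𝒪³}` is `Γ`-stable (`IsGammaStable`) and contains the
support (`SupportIn`) — the two hypotheses of `InvariantRouteAssembly.term_dominated_of_growthInv` besides
`GrowthInv`, `hF` and the theta mass (`exists_gammaStable_supportIn`).  No printed input enters.  Nothing here asserts
anything about the truth of (P); HC_CM is NOT proved by anyone in this repository.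
-/

set_option autoImplicit false

noncomputable section

namespace Summit.Ventures.HodgeRepro.Tier4.Line3

open Summit.Ventures.HodgeRepro.Tier4
open Matrix NumberField

namespace T4Data

variable (X : T4Data)

/-- The `𝒪`-lattice `D⁻¹ 𝒪³`: the `𝒪`-span of the scaled standard basis `D⁻¹ e_i`. -/
def scaledStdLattice (D : RingOfIntegers X.E) : Submodule (RingOfIntegers X.E) (Fin 3 → X.E) :=
  Submodule.span (RingOfIntegers X.E)
    (Set.range fun i : Fin 3 => (algebraMap (RingOfIntegers X.E) X.E D)⁻¹ • (Pi.single i (1 : X.E) : Fin 3 → X.E))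

/-- A vector all of whose coordinates become integral after multiplication by `D` lies in `D⁻¹ 𝒪³`. -/
theorem mem_scaledStdLattice_of_integer {D : RingOfIntegers X.E} (hD : D ≠ 0) (v : Fin 3 → X.E)
    (hv : ∀ i, ∃ m : RingOfIntegers X.E,
      algebraMap (RingOfIntegers X.E) X.E D * v i = algebraMap (RingOfIntegers X.E) X.E m) :
    v ∈ X.scaledStdLattice D := by
  choose m hm using hv
  have hDE : algebraMap (RingOfIntegers X.E) X.E D ≠ 0 := by
    intro h
    exact hD ((map_eq_zero_iff _ (RingOfIntegers.coe_injective (K := X.E))).mp h)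
  have hv' : v = ∑ i, m i • ((algebraMap (RingOfIntegers X.E) X.E D)⁻¹ •
      (Pi.single i (1 : X.E) : Fin 3 → X.E)) := by
    funext k
    rw [Finset.sum_apply]
    simp only [Pi.smul_apply, Pi.single_apply, smul_eq_mul, mul_ite, mul_one, mul_zero, smul_ite, smul_zero,
      Finset.sum_ite_eq, Finset.mem_univ, if_true]
    rw [Algebra.smul_def, ← hm k]
    field_simp
  rw [hv']
  exact Submodule.sum_mem _ fun i _ => Submodule.smul_mem _ _ (Submodule.subset_span ⟨i, rfl⟩)

/-- `D⁻¹ 𝒪³` is stable under the integral matrices of `Γ`. -/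
theorem scaledStdLattice_mulVec_mem {D : RingOfIntegers X.E} (hD : D ≠ 0) {γ : Matrix (Fin 3) (Fin 3) X.E}
    (hγ : γ ∈ X.Γ) {v : Fin 3 → X.E} (hv : v ∈ X.scaledStdLattice D) : γ *ᵥ v ∈ X.scaledStdLattice D := by
  have hγint : IsIntegralMatrix γ := isIntegralMatrix_of_mem X.c X.H X.hΓ hγ
  have hDE : algebraMap (RingOfIntegers X.E) X.E D ≠ 0 := by
    intro h
    exact hD ((map_eq_zero_iff _ (RingOfIntegers.coe_injective (K := X.E))).mp h)
  have key : ∀ i : Fin 3,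
      γ *ᵥ ((algebraMap (RingOfIntegers X.E) X.E D)⁻¹ • (Pi.single i (1 : X.E) : Fin 3 → X.E)) ∈
        X.scaledStdLattice D := by
    intro i
    rw [Matrix.mulVec_smul]
    refine X.mem_scaledStdLattice_of_integer hD _ fun k => ⟨entryInt γ k i, ?_⟩
    rw [coe_entryInt hγint, Pi.smul_apply, smul_eq_mul, Matrix.mulVec_single_one, Matrix.col_apply,
      mul_inv_cancel_left₀ hDE]
  refine Submodule.span_induction (p := fun v _ => γ *ᵥ v ∈ X.scaledStdLattice D) ?_ ?_ ?_ ?_ hv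
  · rintro _ ⟨i, rfl⟩
    exact key i
  · rw [Matrix.mulVec_zero]
    exact Submodule.zero_mem _
  · intro x y _ _ hx hy
    rw [Matrix.mulVec_add]
    exact Submodule.add_mem _ hx hy
  · intro a x _ hx
    rw [Matrix.mulVec_smul]
    exact Submodule.smul_mem _ a hx

/-- Finitely many finitely generated `𝒪`-submodules of `E′³` lie in one `D⁻¹ 𝒪³` (`D ≠ 0`): a common denominator of
their generators' coordinates. -/
theorem exists_scaledStdLattice_ge (S : Finset (Submodule (RingOfIntegers X.E) (Fin 3 → X.E)))
    (hS : ∀ L ∈ S, L.FG) : ∃ D : RingOfIntegers X.E, D ≠ 0 ∧ ∀ L ∈ S, L ≤ X.scaledStdLattice D := by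
  classical
  have hfg : (S.sup id).FG := Submodule.fg_finset_sup S id hS
  obtain ⟨t, ht⟩ := hfg
  obtain ⟨b, hb⟩ := IsLocalization.exist_integer_multiples (nonZeroDivisors (RingOfIntegers X.E))
    (t ×ˢ (Finset.univ : Finset (Fin 3))) (fun p : (Fin 3 → X.E) × Fin 3 => p.1 p.2)
  refine ⟨b, nonZeroDivisors.ne_zero b.2, fun L hL => ?_⟩
  refine (Finset.le_sup (f := id) hL).trans ?_
  rw [← ht, Submodule.span_le]
  intro v hv
  refine X.mem_scaledStdLattice_of_integer (nonZeroDivisors.ne_zero b.2) v fun i => ?_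
  obtain ⟨m, hm⟩ := hb (v, i) (Finset.mem_product.mpr ⟨hv, Finset.mem_univ i⟩)
  refine ⟨m, ?_⟩
  rw [Algebra.smul_def] at hm
  exact hm.symm

/-- **THE `Γ`-STABLE SUPPORT SET** (rung (I2)): for every localiser there is a `Γ`-stable set of line tuples containing
its support — the lines of `(D⁻¹ 𝒪³)⁴` for a common denominator `D` of the support lattices. -/
theorem exists_gammaStable_supportIn (D : X.ThetaData) (p : IsDedekindDomain.HeightOneSpectrum (RingOfIntegers X.E))
    (L₀ : Submodule (RingOfIntegers X.E) (Fin 3 → X.E)) (xm : X.Tuple) (ℓ : X.LocS D p L₀ xm) :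
    ∃ S' : Set X.LineTuple, X.IsGammaStable S' ∧ X.SupportIn D p L₀ xm ℓ S' := by
  obtain ⟨S, hS, hsupp⟩ := ℓ.supp
  obtain ⟨D₀, hD₀, hle⟩ := X.exists_scaledStdLattice_ge S (fun L hL => (hS L hL).1.1)
  refine ⟨{w | ∃ x : X.Tuple, X.lines x = w ∧ ∀ j, x j ∈ X.scaledStdLattice D₀}, ?_, ?_⟩
  · rintro γ hγ x ⟨x', hx', hx'L⟩
    obtain ⟨t, ht, hxt⟩ := X.exists_torus_of_lines_eq hx'.symm
    refine ⟨fun j => γ *ᵥ x' j, ?_, fun j => X.scaledStdLattice_mulVec_mem hD₀ hγ (hx'L j)⟩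
    funext j
    show Quot.mk _ (γ *ᵥ x' j) = Quot.mk _ (γ *ᵥ x j)
    rw [hxt j, Matrix.mulVec_smul]
    exact (Quot.sound ⟨t j, ht j, rfl⟩).symm
  · intro N w hc
    obtain ⟨x, hx, L, hL, hball⟩ := hsupp N w hc
    refine ⟨x, hx, fun j => ?_⟩
    have h1 : x j - xm j ∈ L := Submodule.smul_le_right (hball j)
    have h2 : xm j ∈ L := (hS L hL).2 j
    have h3 : x j = (x j - xm j) + xm j := by ring
    rw [h3]
    exact hle L hL (L.add_mem h1 h2)

end T4Data

end Summit.Ventures.HodgeRepro.Tier4.Line3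

end
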